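import Mathlib
import HarnessLib

/-!
# From `Γ`-invariant equivariant characters to all equivariant characters along a unipotent operator:
# if every equivariant `μ : A → S` with `μ ∘ γ = μ` vanishes and `(γ − 1)^N A ⊆ pA`, `pS = 0`, then every
# equivariant `μ : A → S` vanishes (Nakayama for `Λ/(p, (γ-1)^N)`, finite level; no named fact)

Topic `RepresentationTheory/FiniteGroups` (namespace = path).  THEOREM-ONLY file (no definition, no named fact, no `sorry`),
written by the prover seat `bsd-potss-k8t-c4` g25 (cell `bsd-potss`; `--supports` stmt-BirchSwinnertonDyer-19982; closes nothing;
nothing about number fields is used or claimed here).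

## The mathematics

`A`, `S` additive commutative groups, `p • S = 0`; `g ∈ End(A)` an additive endomorphism («`γ`») with `D = g − 1` satisfying
`D^N A ⊆ p•A` for some `N` (e.g. `γ` of order `pⁿ` acting on a finite group: `(γ−1)^{pⁿ} ≡ γ^{pⁿ} − 1 = 0 (mod p)`); a predicate
`P` on additive maps `A → S` («`G`-equivariant») stable under `μ ↦ μ ∘ D` (the `G`-action commutes with `γ`).  If every `μ`
with `P μ` and `μ ∘ g = μ` is zero, then every `μ` with `P μ` is zero: `μ ∘ D^N = 0` (values `p • μ(b) = 0`), and if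
`μ ∘ D^{i+1} = 0` then `μ ∘ D^i` satisfies `P` and is `g`-invariant, hence zero; descending induction gives `μ = μ ∘ D^0 = 0`.

This upgrades the conclusion of the tree's equivariant Iwasawa lemma (door L6:
`NumberFields/EquivariantIwasawaLemma*.lean` — vanishing of the `Γ_k`-equivariant characters of `Cl(L₀K_n)`, i.e. of the
`Gal(L₀K_n/K_n)`-equivariant ones that are moreover invariant under `Gal(L₀K_n/L₀) = ⟨γ⟩`) to the vanishing of ALL
`Gal(L₀K_n/K_n)`-equivariant characters with values in a `p`-torsion module — the input of
`ClassGroupRankEqualityCosetKernel.natCard_torsion_classGroup_fixedField_eq_of_forall_equivariantHom_cosetKernel_eq_zero`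
at the layer `L₀K_n / K_n` (the rank-equality transfer door of the cell's μ-road census; assembly NOT in this file).

## References

Nakayama's lemma for the local ring `ℤ_p[[T]]`, `T = γ − 1`, at finite level (Washington, *Introduction to Cyclotomic
Fields*, §13.2 Lemma 13.16; §13.3 proof of Lemma 13.18). [Washington1997]
-/

namespace Literature.RepresentationTheory.FiniteGroups

variable {A S : Type*} [AddCommGroup A] [AddCommGroup S]

/-- **Unipotent upgrade of an invariant-vanishing statement.**  `g : A →+ A`, `D = g − id`, `D^N A ⊆ p • A`, `p • S = 0`,
`P` a predicate on additive maps `A →+ S` stable under `μ ↦ μ ∘ D`.  If every `μ` with `P μ` and `μ ∘ g = μ` vanishes, then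
every `μ` with `P μ` vanishes (descending induction on `i` in `μ ∘ D^i`; Nakayama for `ℤ_p[[γ − 1]]` at finite level).
[cite: Washington1997, §13.2 Lemma 13.16 (Nakayama's lemma for Λ-modules)] -/
theorem addMonoidHom_eq_zero_of_forall_invariant_eq_zero {p N : ℕ} (hpS : ∀ s : S, p • s = 0)
    (g : AddMonoid.End A) (hnil : ∀ a : A, ∃ b : A, ((g - 1) ^ N) a = p • b)
    (P : (A →+ S) → Prop) (hP : ∀ μ : A →+ S, P μ → P (μ.comp ((g - 1 : AddMonoid.End A))))
    (hvan : ∀ μ : A →+ S, P μ → (∀ a : A, μ (g a) = μ a) → μ = 0)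
    (μ : A →+ S) (hμ : P μ) : μ = 0 := by
  set D : AddMonoid.End A := g - 1 with hDdef
  have hDapp : ∀ a : A, D a = g a - a := fun a => rfl
  -- `P (μ ∘ D^i)` for every `i`
  have hPi : ∀ i : ℕ, P (μ.comp ((D ^ i : AddMonoid.End A))) := by
    intro i
    induction i with
    | zero =>
      have e : (D ^ 0 : AddMonoid.End A) = 1 := pow_zero D
      have h1 : μ.comp ((D ^ 0 : AddMonoid.End A)) = μ := by rw [e]; ext a; rfl
      rw [h1]; exact hμ
    | succ i ih =>
      have e : (D ^ (i + 1) : AddMonoid.End A) = D ^ i * D := pow_succ D i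
      have h1 : μ.comp ((D ^ (i + 1) : AddMonoid.End A)) = (μ.comp ((D ^ i : AddMonoid.End A))).comp (D : AddMonoid.End A) := by
        rw [e]; ext a; rfl
      rw [h1]; exact hP _ ih
  -- `μ ∘ D^N = 0`
  have hN : μ.comp ((D ^ N : AddMonoid.End A)) = 0 := by
    ext a
    obtain ⟨b, hb⟩ := hnil a
    rw [AddMonoidHom.comp_apply, AddMonoidHom.zero_apply]
    change μ ((D ^ N) a) = 0
    rw [hb, map_nsmul, hpS]
  -- descending induction: `μ ∘ D^{N-j} = 0` for all `j ≤ N`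
  have hdesc : ∀ j : ℕ, j ≤ N → μ.comp ((D ^ (N - j) : AddMonoid.End A)) = 0 := by
    intro j
    induction j with
    | zero => intro _; rw [Nat.sub_zero]; exact hN
    | succ j ih =>
      intro hj
      have hprev := ih (Nat.le_of_succ_le hj)
      have hidx : N - j = (N - (j + 1)) + 1 := by omega
      have epow : (D ^ (N - j) : AddMonoid.End A) = D ^ (N - (j + 1)) * D := by rw [hidx, pow_succ]
      set ν := μ.comp ((D ^ (N - (j + 1)) : AddMonoid.End A)) with hνdef
      have hνg : ∀ a : A, ν (g a) = ν a := by
        intro a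
        have h1 : ν (g a) - ν a = (μ.comp ((D ^ (N - j) : AddMonoid.End A))) a := by
          rw [epow, ← map_sub]
          change μ ((D ^ (N - (j + 1))) (g a - a)) = μ ((D ^ (N - (j + 1)) * D) a)
          rw [← hDapp]
          rfl
        rw [hprev, AddMonoidHom.zero_apply] at h1
        exact sub_eq_zero.mp h1
      exact hvan ν (hPi _) hνg
  have h0 := hdesc N le_rfl
  have e0 : (D ^ (N - N) : AddMonoid.End A) = 1 := by rw [Nat.sub_self, pow_zero]
  rw [e0] at h0
  have h1 : μ.comp ((1 : AddMonoid.End A)) = μ := by ext a; rfl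
  rw [h1] at h0
  exact h0

/-- `(X − 1)^{p^n} − (X^{p^n} − 1)` has all coefficients divisible by `p` (Frobenius in `𝔽_p[X]`). [folklore] -/
private theorem exists_sub_one_pow_prime_pow (p : ℕ) [hp : Fact p.Prime] (n : ℕ) :
    ∃ q : Polynomial ℤ, (Polynomial.X - 1 : Polynomial ℤ) ^ (p ^ n) =
      Polynomial.X ^ (p ^ n) - 1 + Polynomial.C (p : ℤ) * q := by
  set F : Polynomial ℤ := (Polynomial.X - 1) ^ (p ^ n) - (Polynomial.X ^ (p ^ n) - 1) with hF
  have hmap : Polynomial.map (Int.castRingHom (ZMod p)) F = 0 := by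
    rw [hF, Polynomial.map_sub, Polynomial.map_pow, Polynomial.map_sub, Polynomial.map_X, Polynomial.map_one,
      Polynomial.map_sub, Polynomial.map_pow, Polynomial.map_X, Polynomial.map_one,
      sub_pow_char_pow, one_pow, sub_self]
  have hdvd : Polynomial.C (p : ℤ) ∣ F := by
    rw [Polynomial.C_dvd_iff_dvd_coeff]
    intro i
    have hi := congrArg (fun P : Polynomial (ZMod p) => P.coeff i) hmap
    simp only [Polynomial.coeff_map, Polynomial.coeff_zero, eq_intCast] at hi
    exact (ZMod.intCast_zmod_eq_zero_iff_dvd _ p).mp hi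
  obtain ⟨q, hq⟩ := hdvd
  refine ⟨q, ?_⟩
  rw [← hq, hF]
  abel

/-- **The nilpotency input for an endomorphism of `p`-power order**: if `g^{p^n} = 1` in `End(A)`, then
`(g − 1)^{p^n} a ∈ p • A` for every `a` — `(X − 1)^{p^n} ≡ X^{p^n} − 1 (mod p)` in `ℤ[X]`, evaluated at `g`.
[cite: Washington1997, §13.2 Lemma 13.16 (Nakayama's lemma for Λ-modules)] -/
theorem exists_pow_sub_one_apply_eq_nsmul {p : ℕ} (hp : p.Prime) (n : ℕ) (g : AddMonoid.End A)
    (hg : g ^ (p ^ n) = 1) (a : A) :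
    ∃ b : A, ((g - 1) ^ (p ^ n)) a = p • b := by
  haveI : Fact p.Prime := ⟨hp⟩
  obtain ⟨q, hq⟩ := exists_sub_one_pow_prime_pow p n
  -- evaluate at `g` in the ring `AddMonoid.End A`
  have hev := congrArg (fun P : Polynomial ℤ => Polynomial.aeval (R := ℤ) g P) hq
  simp only [map_pow, map_sub, map_add, map_mul, Polynomial.aeval_X, map_one, map_natCast] at hev
  rw [hg, sub_self, zero_add] at hev
  refine ⟨Polynomial.aeval (R := ℤ) g q a, ?_⟩
  rw [hev]
  rfl

end Literature.RepresentationTheory.FiniteGroups
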